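import Summits.AtomisticToContinuum.FouriersLaw.Theses.JunctionLocality
import Summits.AtomisticToContinuum.FouriersLaw.Theses.PuiseuxTransferLedger
import Summits.AtomisticToContinuum.FouriersLaw.Theses.BondHeatUncertainty
import Summits.AtomisticToContinuum.FouriersLaw.Theses.HonestZwanzig
import Summits.AtomisticToContinuum.FouriersLaw.Theorems.JunctionLocalityDefs
import Summits.AtomisticToContinuum.FouriersLaw.Theorems.JunctionLocalityNonBallisticStubProfileIntegrable
import Summits.AtomisticToContinuum.FouriersLaw.Theorems.JunctionLocalityNonBallisticStubMidpointContraction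
import Summits.AtomisticToContinuum.FouriersLaw.Theorems.JunctionLocalityNonBallisticStubColumnFlatGreenKubo
import Summits.AtomisticToContinuum.FouriersLaw.Theorems.JunctionLocalityNonBallisticStubLightConeWindow
import Summits.AtomisticToContinuum.FouriersLaw.Theorems.BondHeatUncertaintySubdiffusiveBondHeatKernelDetailedBalance
import Summits.AtomisticToContinuum.FouriersLaw.Theorems.OddSectorIrreversibilityCorrectorTheoryUniformMixing
import Literature.MathematicalPhysics.KineticTheory.LangevinChainKernel
import Literature.MathematicalPhysics.KineticTheory.LangevinChainGibbs

/-!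
# Line `contact-current-forgetting` — crux `JunctionLocality.NonBallistic` (stmt-AtomisticToContinuum-9127)

Lead's skeleton, reshape R3 (prover-line-stmt-AtomisticToContinuum-9127-1, 2026-08-16, continuing lead -0's R1/R2 of the
planner's checked skeleton `Lines/contact_current_forgetting.lean`). STATE: the composition closes the crux BY NAME from
ONE registered stub, `stub_recurrentContactForgetting` (RCF, the transferred crux `C⁺`); the six other statements of
the line are THEOREMS of the tree (GK p94764, DB p91142, CF p89265, LC p92000, MP p85980, PI p85907).

THE LINE. Fix `ω₂, lam, β, γ > 0`, `T > 0`, `P = pinnedChain ω₂ lam β γ`, the `N`-site open chain with BOTH Langevin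
baths at `T` — the constructed kernels `κ_s = P.transitionKernel N T T s` (Chapman–Kolmogorov `pinnedChain_transitionKernel_add`,
Gibbs invariance `pinnedChain_gibbsMeasure_bind_transitionKernel`, exponential convergence `pinnedChain_exp_convergence_gibbs`,
all proved in tree WITHOUT the uniqueness hypothesis) and the Gibbs state `μ_T = P.gibbsMeasure N T`. Write `j_b` for the
bond currents, `J = Σ_b j_b`, `G_N = D_N/(N−1)` for the conductance of clause (ii), and
  `M_N(b,b′)(t) = ⟨j_b, κ_t j_{b′}⟩_{μ_T}`                      (`gkEntry`, the Green–Kubo matrix integrand),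
  `φ_N(s) = ‖κ_s j_0‖²_{L²(μ_T)} + ‖κ_s j_{N−2}‖²_{L²(μ_T)}`     (`contactProfile`, the CONTRACTION PROFILE of the two
                                                                   contact currents — symmetric in the two ends).
* (GK, STUB 1 — LANDED) `T²(N−1)D_N = ∫₀^∞ corr(J,J)`: the Kundu–Dhar–Narayan open-chain Green–Kubo identity = VERBATIM
  the shared route item `HonestZwanzig.OpenChainGreenKubo` (stmt-12696), PROVED in tree by
  `OddSectorIrreversibility.Corrector.openChainGreenKubo_holds` (p94764: response density by uniform Harris mixing +
  KDN identity + uniform decay of the total current); discharged here by that name.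
* (DB, STUB 2 — LANDED) KERNEL DETAILED BALANCE at equal temperatures, `∫ f·(κ_s h) dμ_T = ∫ (h∘Θ)·κ_s(f∘Θ) dμ_T` —
  VERBATIM `SubdiffusiveBondHeat.stub_kernelDetailedBalance` (p91142, crux 9120's line: Laplace-resolvent duality
  A–D + smooth dense class), discharged here by that name.
* (CF, STUB 3 — LANDED p89265) COLUMN-FLAT Green–Kubo matrix (forward-only, fixed `N`): `corr(J,J)(t) = Σ_{b,b′<N−1}
  M_N(b,b′)(t)` and `∫₀^∞ M_N(b,b′) = ∫₀^∞ M_N(b,0)`; with DB the integrated matrix is symmetric, hence FLAT: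
  `T²G_N = ∫₀^∞ M_N(0,N−2)` (`greenKubo_extremePair`).
* (LC, STUB 4 — LANDED p92000) LIGHT-CONE WINDOW: `t₀(N) → ∞`, `η_N·t₀(N) → 0`, `|M_N(0,N−2)(t)| ≤ η_N` on `[0,t₀(N)]`
  (almost-finite propagation speed by synchronous coupling).
* (MP, STUB 5 — LANDED p85980) DB ⇒ Onsager symmetry `M_N(b,b′) = M_N(b′,b)` and the midpoint bound
  `|M_N(0,N−2)(t)| ≤ φ_N(t/2)`.
* (RCF, STUB 6 — OPEN, the lead's) RECURRENT CONTACT FORGETTING (R3 = liminf form of R2's uniform contact forgetting):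
  `∀ ε ∃ s₀ ∀ N₁ ∃ N ≥ N₁, ∫_{s₀}^∞ φ_N ≤ ε` — along some subsequence of lengths the profile tails are uniformly small.
  All the anharmonic, `N`-uniform content of the crux sits here (FALSE at `lam = β = 0`, as the crux: `Disproof.lean` §4;
  kit j013509: harmonic plateau `φ_N ≈ 2·0.066` up to the traversal time for every large `N`).
* (PI, STUB 7 — LANDED p85907) fixed-`N` integrability of `φ_N` on `(0,∞)`.
* COMPOSITION (`NonBallistic_of`, sorry-free, UNARY): `T²G_N = ∫₀^{t₀}M + ∫_{t₀}^∞M ≤ η_Nt₀ + 2∫_{t₀/2}^∞φ_N ≤ η_Nt₀ +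
  2∫_{s₀}^∞φ_N < T²ε` at ONE `N` beyond `N₀` and beyond the two LC eventualities (`η_Nt₀ < T²ε/4`, `t₀(N) ≥ 2s₀`, valid
  for all large `N`) at which RCF gives the tail bound; so `D_N ≤ ε(N−1)` beyond every `N₀`.

RESHAPES. R1 (lead -0, vs the planner's six stubs): DB made its own stub (shared verbatim with crux 9120), flatness split
into CF + Onsager symmetry from DB, midpoint inequality as the implication MP, profile symmetrised in the two ends,
uniqueness dropped from every stub but GK. R2 (lead -0): planner's stubs 5+6 merged and weakened into UCF (uniformly
small tails) + PI split off. R3 (lead -1, this file): GK and DB DISCHARGED by the theorems that landed for items 12696 /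
9120 (the stubs were verbatim those statements); UCF weakened to its liminf form RCF (`recurrent_of_uniform`: R2 ⇒ R3),
which is exactly the quantifier shape of the crux and still all the composition consumes. Vocabulary = the route Defs
file `Theorems/JunctionLocalityDefs.lean` (p84738).

WHAT RCF NEEDS (lead's analysis `UniformContactForgettingAnalysis.md` in this directory, updated R3): only the tail of
`φ_N` beyond the light-cone time matters (`∫₀^{t₀/2} φ_N` is never used); the enemy is profile mass at diverging times
(slow hydrodynamic / Thouless modes loading the contact current); heuristically `φ_N(s) ≍ C_T s^{−3/2}` then
`N^{−3}e^{−cs/N²}`, so `∫_{s₀}^∞ φ_N ≈ 2C_T s₀^{−1/2} + O(N^{−1/2})`. No engine in print gives an `N`-uniform decay of one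
semigroup orbit for a deterministic anharmonic bulk (BLR2000 §6.3); RCF is of Green–Kubo depth (it gives `G_N → 0` along
a subsequence) but is not the crux in costume (equilibrium, one vector, no NESS, no response).

DISPROOF USED (`Cruxes/NonBallistic/Disproof.lean`, gen 2 v5, re-read 2026-08-16T10:30Z): §3 necessity (nothing to
honour); §4 anharmonicity load-bearing — honoured: `0 < lam`, `0 < β` are USED only in RCF (GK, DB, CF, LC, MP, PI hold
at the harmonic corner); §7 scaling — RCF is `∀ T > 0` with `T`-dependent `s₀(ε,T)`; §5/§6 not on this line's path;
`## Targets`: none yet. `Theorems/NonBallistic/Negative/FalseWithoutAnharmonicity.lean` (p82917) is the crux-level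
harmonic kill, consistent with RCF's harmonic failure. Shape (D-0027 §3.3): `Holds.stub_<name> : <statement>` (`sorry`
only in RCF) + `def stub_<name> : Prop := type_of% Holds.stub_<name>`; `NonBallistic_of` takes the ONE open handle and
concludes the crux BY NAME; `NonBallistic_proof` is the `<Crux>_proof`; `NonBallistic_puiseux_of` /
`NonBallistic_bondHeat_of` the verbatim twins.
-/

noncomputable section

open MeasureTheory Set Filter Topology
open scoped BigOperators

namespace Summit.AtomisticToContinuum.FouriersLaw.Cruxes.NonBallistic.ContactCurrentForgetting

open Literature.MathematicalPhysics.KineticTheory.HeatConduction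
open Summit.AtomisticToContinuum.FouriersLaw.Theses.JunctionLocality (NonBallistic)
open Summit.AtomisticToContinuum.FouriersLaw.Theses.HonestZwanzig (OpenChainGreenKubo)

/-! ## Kernel-level objects of the open chain at equilibrium (both baths at `T`)

The vocabulary — `evolve`, `bondCurrentAt`, `totalCurrentObs`, `gkEntry`, `totalCorr`, `contactProfile` — is the route Defs file
`Theorems/JunctionLocalityDefs.lean` (namespace `Summit.AtomisticToContinuum.FouriersLaw.Theorems.JunctionLocality`, landed p84738),
opened below; the stub files import the same module, so registered signatures and landed theorems denote the same constants. -/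

open Summit.AtomisticToContinuum.FouriersLaw.Theorems.JunctionLocality

/-! ## Registered stubs (the lemmas of the line; `sorry` only here) -/

/-- **STUB 1 (GK) — `stub_openChainGreenKubo` — LANDED** (item stmt-12696 PROVED in tree, p94764:
`OddSectorIrreversibility.Corrector.openChainGreenKubo_holds`, file `Theorems/OddSectorIrreversibilityCorrectorTheoryUniformMixing.lean`;
`openChainGreenKubo_iff` is `Iff.rfl`, so that theorem IS this statement). Kundu–Dhar–Narayan open-chain Green–Kubo identity (SHARED).
Under weak-NESS uniqueness, for every steady-state family `μf`, every `T > 0` and `N ≥ 2`: `t ↦ corr(J,J)(t)` is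
integrable on `(0,∞)` and the clause-(ii) response quotient tends, as `δ → 0`, `δ ≠ 0`, to `∫₀^∞ corr(J,J)/((N−1)T²)`.
VERBATIM the route item `HonestZwanzig.OpenChainGreenKubo` (stmt-AtomisticToContinuum-12696; `openChainGreenKubo_iff`).
Rigorous route: differentiability of the NESS at equilibrium (Hairer–Majda 2009 Thm 2.3 / the response density of
`OddSectorIrreversibility.ResponseDensity`, stmt-9144) + the single-bond Kubo formula `OscillatorChain.KuboFormula`
(BLR (32), a Literature DEFINITION, content of `FiniteResponseOfUnique` stmt-0717) + column flatness (CF). True at the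
harmonic corner. -/
theorem Holds.stub_openChainGreenKubo :
    ∀ ω₂ lam β γ : ℝ, 0 < ω₂ → 0 < lam → 0 < β → 0 < γ →
    (∀ (N : ℕ) (T_L T_R : ℝ), 0 < T_L → 0 < T_R → ∀ μ ν : Measure (PhaseSpace N),
      (pinnedChain ω₂ lam β γ).IsSteadyState N T_L T_R μ →
      (pinnedChain ω₂ lam β γ).IsSteadyState N T_L T_R ν → μ = ν) →
    ∀ μf : (N : ℕ) → ℝ → ℝ → Measure (PhaseSpace N),
      (∀ (N : ℕ) (T_L T_R : ℝ), 0 < T_L → 0 < T_R →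
        (pinnedChain ω₂ lam β γ).IsSteadyState N T_L T_R (μf N T_L T_R)) →
    ∀ T : ℝ, 0 < T → ∀ N : ℕ, 2 ≤ N →
      IntegrableOn (totalCorr (pinnedChain ω₂ lam β γ) N T) (Ioi 0) ∧
      Tendsto (fun δ : ℝ => (pinnedChain ω₂ lam β γ).totalCurrent (μf N (T + δ / 2) (T - δ / 2)) / δ)
        (nhdsWithin 0 {(0 : ℝ)}ᶜ)
        (nhds ((∫ t in Ioi (0 : ℝ), totalCorr (pinnedChain ω₂ lam β γ) N T t) / (((N : ℝ) - 1) * T ^ 2))) :=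
  Summit.AtomisticToContinuum.FouriersLaw.Theorems.OddSectorIrreversibility.Corrector.openChainGreenKubo_holds

/-- **STUB 2 (DB) — `stub_kernelDetailedBalance` — LANDED** (p91142: `SubdiffusiveBondHeat.stub_kernelDetailedBalance`, file
`Theorems/BondHeatUncertaintySubdiffusiveBondHeatKernelDetailedBalance.lean`, crux 9120's line; SHARED verbatim, same stub
name, so that theorem IS this statement). Detailed balance of the constructed equal-temperature kernels under
momentum reversal `Θ(q,p) = (q,−p)`, weak `L²(μ_T)` form: `∫ f·(P_s h) dμ_T = ∫ (h∘Θ)·P_s(f∘Θ) dμ_T` for measurable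
`f, h` with `f², h² ∈ L¹(μ_T)` (`N ≥ 2`, `s ≥ 0`). In tree: Lebesgue path duality `stub_pathLebesgueDuality` (LANDED,
`…LinearResponseFTURPathLebesgueDuality`), the Doob–Dynkin identity for `e^{2γt}ρ⁻¹P̂_t(ρ·)` with the flipped generator
(`…SubdiffusiveBondHeatKernelDoobTransform`), Gibbs invariance, `Θ_*μ_T = μ_T`; missing: the anti-damped Girsanov
identity (K3 `stub_antiDampedGirsanov` of crux 9122, in progress) or uniqueness of Markov semigroups with a common
Dynkin identity on `C_c²` (`Cruxes/SubdiffusiveBondHeat/DetailedBalanceAnalysis.md`). True at the harmonic corner. -/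
theorem Holds.stub_kernelDetailedBalance :
    ∀ ω₂ lam β γ : ℝ, 0 < ω₂ → 0 < lam → 0 < β → 0 < γ → ∀ T : ℝ, 0 < T → ∀ (N : ℕ) (hN : 1 < N),
      ∀ (s : NNReal) (f h : PhaseSpace N → ℝ), Measurable f → Measurable h →
        Integrable (fun y => f y ^ 2) ((pinnedChain ω₂ lam β γ).gibbsMeasure N T) →
        Integrable (fun y => h y ^ 2) ((pinnedChain ω₂ lam β γ).gibbsMeasure N T) →
        ∫ y, f y * (∫ y', h y' ∂((pinnedChain ω₂ lam β γ).transitionKernel N T T s) y)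
            ∂((pinnedChain ω₂ lam β γ).gibbsMeasure N T) =
          ∫ y, h (y.1, -y.2) * (∫ y', f (y'.1, -y'.2) ∂((pinnedChain ω₂ lam β γ).transitionKernel N T T s) y)
            ∂((pinnedChain ω₂ lam β γ).gibbsMeasure N T) :=
  Summit.AtomisticToContinuum.FouriersLaw.Theorems.SubdiffusiveBondHeat.stub_kernelDetailedBalance

/-- **STUB 3 (CF) — `stub_columnFlatGreenKubo` — LANDED** (p89265, worker w-CF: `Theorems/JunctionLocalityNonBallisticStubColumnFlatGreenKubo.lean`,
helpers Aux1 p86086 `pinnedChain_generator_splitSiteEnergy` (L ẽ_b = j_a − j_b at an interior site), Aux2 p87662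
`pinnedChain_splitSiteEnergy_dynkin`; by-product p88350 closes route item `HonestZwanzig.GeneratorSiteEnergy`, stmt-12698).
Forward-only column flatness of the equilibrium Green–Kubo matrix (fixed `N`): `corr(J,J)(t) = Σ_{b,b′<N−1} M_N(b,b′)(t)` for
`t ≥ 0`, every entry integrable on `(0,∞)`, and `∫₀^∞ M_N(b,b′) = ∫₀^∞ M_N(b,0)`. No longer a stub. -/
theorem Holds.stub_columnFlatGreenKubo :
    ∀ ω₂ lam β γ : ℝ, 0 < ω₂ → 0 < lam → 0 < β → 0 < γ → ∀ T : ℝ, 0 < T → ∀ N : ℕ, 2 ≤ N →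
      (∀ t : ℝ, 0 ≤ t → totalCorr (pinnedChain ω₂ lam β γ) N T t =
        ∑ b ∈ Finset.range (N - 1), ∑ b' ∈ Finset.range (N - 1), gkEntry (pinnedChain ω₂ lam β γ) N T b b' t) ∧
      ∀ b b' : ℕ, b + 1 < N → b' + 1 < N →
        IntegrableOn (gkEntry (pinnedChain ω₂ lam β γ) N T b b') (Ioi 0) ∧
        ∫ t in Ioi (0 : ℝ), gkEntry (pinnedChain ω₂ lam β γ) N T b b' t =
          ∫ t in Ioi (0 : ℝ), gkEntry (pinnedChain ω₂ lam β γ) N T b 0 t :=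
  Summit.AtomisticToContinuum.FouriersLaw.Theorems.NonBallistic.stub_columnFlatGreenKubo

/-- **STUB 4 (LC) — `stub_lightConeWindow` — LANDED** (`Theorems/JunctionLocalityNonBallisticStubLightConeWindow.lean`,
lead + workers w-LC/w-FSA/w-FSBC/w-FSD; ≈ 20 accepted helper files). Thermal light-cone window for the extreme pair: a window
`t₀(N) → ∞` and levels `η_N` with `η_N·t₀(N) → 0` and `|M_N(0,N−2)(t)| ≤ η_N` for `N ≥ 2`, `0 ≤ t ≤ t₀(N)`. Proof =
almost-finite propagation speed of the open anharmonic chain by the SYNCHRONOUS COUPLING: two strong solutions driven by the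
same Brownian pair from `x` and from the contact-flipped `Θ₀Θ₁x` differ at the far bond by `≤ 4|p|2^{−(N−3)}` inside the
light cone `6eA R_N² t ≤ N − 3` (Dobrushin–Fritz iteration on the box `|q| ≤ R_N`, `R_N² = O(√N)` off a bad event of
probability `O(e^{−N} + 1/N)` controlled by the Gibbs energy tail, the momentum tail and the fourth moment of the current);
Jensen turns it into kernel flip-insensitivity, the contact-momenta flip pairing into fixed-time locality of `M_N(0,N−2)`,
and a diagonal argument into the window. No longer a stub. -/
theorem Holds.stub_lightConeWindow :
    ∀ ω₂ lam β γ : ℝ, 0 < ω₂ → 0 < lam → 0 < β → 0 < γ → ∀ T : ℝ, 0 < T →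
      ∃ t₀ η : ℕ → ℝ, (∀ N, 0 ≤ t₀ N) ∧ Tendsto t₀ atTop atTop ∧
        Tendsto (fun N => η N * t₀ N) atTop (𝓝 0) ∧
        ∀ N : ℕ, 2 ≤ N → ∀ t : ℝ, 0 ≤ t → t ≤ t₀ N →
          |gkEntry (pinnedChain ω₂ lam β γ) N T 0 (N - 2) t| ≤ η N :=
  Summit.AtomisticToContinuum.FouriersLaw.Theorems.NonBallistic.stub_lightConeWindow

/-- **STUB 5 (MP) — `stub_midpointContraction` — LANDED** (p85980, lead: `Theorems/JunctionLocalityNonBallisticStubMidpointContraction.lean`).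
Kernel detailed balance (the text of `stub_kernelDetailedBalance`, verbatim) ⇒ Onsager symmetry of the Green–Kubo matrix
integrand, `M_N(b,b′)(t) = M_N(b′,b)(t)` (`t ≥ 0`), and the midpoint bound `|M_N(0,N−2)(t)| ≤ φ_N(t/2)` (Chapman–Kolmogorov
`pinnedChain_transitionKernel_add`, DB with `h = κ_{t/2} j_{N−2} ∈ L²(μ_T)` (`pinnedChain_integral_sq_act_le`), `Θ j = −j`,
`|ab| ≤ (a²+b²)/2`, `Θ_*μ_T = μ_T`). No longer a stub: discharged by the landed theorem. -/
theorem Holds.stub_midpointContraction :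
    (∀ ω₂ lam β γ : ℝ, 0 < ω₂ → 0 < lam → 0 < β → 0 < γ → ∀ T : ℝ, 0 < T → ∀ (N : ℕ) (hN : 1 < N),
      ∀ (s : NNReal) (f h : PhaseSpace N → ℝ), Measurable f → Measurable h →
        Integrable (fun y => f y ^ 2) ((pinnedChain ω₂ lam β γ).gibbsMeasure N T) →
        Integrable (fun y => h y ^ 2) ((pinnedChain ω₂ lam β γ).gibbsMeasure N T) →
        ∫ y, f y * (∫ y', h y' ∂((pinnedChain ω₂ lam β γ).transitionKernel N T T s) y)
            ∂((pinnedChain ω₂ lam β γ).gibbsMeasure N T) =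
          ∫ y, h (y.1, -y.2) * (∫ y', f (y'.1, -y'.2) ∂((pinnedChain ω₂ lam β γ).transitionKernel N T T s) y)
            ∂((pinnedChain ω₂ lam β γ).gibbsMeasure N T)) →
    ∀ ω₂ lam β γ : ℝ, 0 < ω₂ → 0 < lam → 0 < β → 0 < γ → ∀ T : ℝ, 0 < T → ∀ N : ℕ, 2 ≤ N →
      (∀ b b' : ℕ, ∀ t : ℝ, 0 ≤ t →
        gkEntry (pinnedChain ω₂ lam β γ) N T b b' t = gkEntry (pinnedChain ω₂ lam β γ) N T b' b t) ∧
      ∀ t : ℝ, 0 ≤ t →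
        |gkEntry (pinnedChain ω₂ lam β γ) N T 0 (N - 2) t| ≤
          contactProfile (pinnedChain ω₂ lam β γ) N T (t / 2) :=
  Summit.AtomisticToContinuum.FouriersLaw.Theorems.NonBallistic.stub_midpointContraction

/-- **STUB 6 (RCF) — `stub_recurrentContactForgetting` (the transferred crux `C⁺`, reshape R3 = the LIMINF form of
uniform contact forgetting; size XL; HARDEST; held by the lead; the ONLY open stub of the line).** For `T > 0` and every
`ε > 0` there is a time `s₀ ≥ 0` such that BEYOND EVERY LENGTH `N₁` some chain `N ≥ N₁` has profile tail mass
`∫_{s₀}^∞ φ_N ≤ ε`: `∀ ε ∃ s₀ ∀ N₁ ∃ N ≥ N₁, ∫_{s₀}^∞ φ_N ≤ ε` — equivalently, along SOME subsequence of lengths the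
contraction profiles `(φ_{N_k})_k` are uniformly integrable at `s = ∞`; equivalently (`φ_N ≥ 0`), for every window
`t_N → ∞`, `liminf_N ∫_{t_N}^∞ φ_N = 0`. R3 weakens R2 (`∃ N₁ ∀ N ≥ N₁`, uniform integrability of the whole family:
`recurrent_of_uniform`) to exactly the quantifier shape of the crux (`∀ N₀ ∃ N ≥ N₀`, a liminf), and it is still all that
`NonBallistic_of` consumes together with the light cone: `T²G_N ≤ η_N t₀(N) + 2∫_{t₀(N)/2}^∞ φ_N`, the two LC
eventualities holding for ALL large `N`, the tail bound being needed at ONE `N` beyond them. Expected truth (diffusive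
phenomenology): `φ_N(s) ≲ C_T (1+s)^{−3/2}` uniformly in `N` up to the Thouless time and `∫_{cN}^∞ φ_N ≍ N^{−1/2}`,
after a plateau up to the kinetic time `≍ (lam·T)⁻²` (`s₀ = s₀(ε,T)` degrades as `lam·T → 0`:
`LowTemperatureWeakAnharmonicity`, `Disproof.lean` §7). Engine NOT in print: observable-adapted weak hypocoercivity /
weak Poincaré with `N`-free constants for ONE vector (the contact current) at the dissipative site, driven by the exact
dissipation law `φ_N′ = −2γT Σ_c ‖∂_{p_c}κ_s j‖²` (RöcknerWang2001, GrothausWang2019, Villani2009, HairerMattingly2009 are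
fixed-dimension); every fixed-`N` fact about `φ_N` is landed (`φ_N ≥ 0`, antitone p87076, `φ_N ≤ C` uniformly
`contactProfile_le_uniform`, `φ_N ∈ L¹` PI p85907, midpoint domination MP p85980). FALSE at `lam = β = 0` (kit j013509:
plateau `φ_N ≈ 2·0.066` up to `(N−2)/v`, so `∫_{s₀}^∞ φ_N ≳ 0.13(N/v − s₀) → ∞` for EVERY large `N`) and under a
hidden odd conserved charge (Mazur: `φ_N ≳ N⁻¹` on `s ≲ N²`) — exactly as the crux; this is where `0 < lam`, `0 < β`
are used. A kill needs `∃ ε ∀ s₀ ∃ N₁ ∀ N ≥ N₁, ∫_{s₀}^∞ φ_N > ε` (a tail floor for ALL long chains). -/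
theorem Holds.stub_recurrentContactForgetting :
    ∀ ω₂ lam β γ : ℝ, 0 < ω₂ → 0 < lam → 0 < β → 0 < γ → ∀ T : ℝ, 0 < T → ∀ ε : ℝ, 0 < ε →
      ∃ s₀ : ℝ, 0 ≤ s₀ ∧ ∀ N₁ : ℕ, ∃ N : ℕ, N₁ ≤ N ∧
        ∫ s in Ioi s₀, contactProfile (pinnedChain ω₂ lam β γ) N T s ≤ ε := by
  sorry

/-- **STUB 7 (PI) — `stub_profileIntegrable` — LANDED** (p85907, worker w-PI, wave 1:
`Theorems/JunctionLocalityNonBallisticStubProfileIntegrable.lean`, with the reusable helpers `pinnedChain_measurable_sqAct`,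
`pinnedChain_sqAct_exp_decay`, `pinnedChain_sqAct_integrableOn`). For `T > 0` and every `N ≥ 2`, `φ_N` is integrable on
`(0,∞)` (exponential convergence to `μ_T(j) = 0`, measurability from joint measurability). No longer a stub: discharged by
the landed theorem. -/
theorem Holds.stub_profileIntegrable :
    ∀ ω₂ lam β γ : ℝ, 0 < ω₂ → 0 < lam → 0 < β → 0 < γ → ∀ T : ℝ, 0 < T → ∀ N : ℕ, 2 ≤ N →
      IntegrableOn (contactProfile (pinnedChain ω₂ lam β γ) N T) (Ioi 0) :=
  Summit.AtomisticToContinuum.FouriersLaw.Theorems.NonBallistic.stub_profileIntegrable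

/-! ### By-name handles of the seven statements (no second copy of the text) -/

/-- Statement of registered stub 1 (`Holds.stub_openChainGreenKubo`), by name. -/
def stub_openChainGreenKubo : Prop := type_of% Holds.stub_openChainGreenKubo
/-- Statement of registered stub 2 (`Holds.stub_kernelDetailedBalance`), by name. -/
def stub_kernelDetailedBalance : Prop := type_of% Holds.stub_kernelDetailedBalance
/-- Statement of registered stub 3 (`Holds.stub_columnFlatGreenKubo`), by name. -/
def stub_columnFlatGreenKubo : Prop := type_of% Holds.stub_columnFlatGreenKubo
/-- Statement of registered stub 4 (`Holds.stub_lightConeWindow`), by name. -/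
def stub_lightConeWindow : Prop := type_of% Holds.stub_lightConeWindow
/-- Statement of registered stub 5 (`Holds.stub_midpointContraction`), by name. -/
def stub_midpointContraction : Prop := type_of% Holds.stub_midpointContraction
/-- Statement of registered stub 6 (`Holds.stub_recurrentContactForgetting`, R3), by name. -/
def stub_recurrentContactForgetting : Prop := type_of% Holds.stub_recurrentContactForgetting

/-- R2 ⟹ R3: UNIFORM contact forgetting (the R2 text `∀ ε ∃ s₀ ∃ N₁ ∀ N ≥ N₁, ∫_{s₀}^∞ φ_N ≤ ε`, uniform
integrability of the whole family at `s = ∞`) implies the registered liminf form. [folklore] -/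
theorem recurrent_of_uniform
    (h : ∀ ω₂ lam β γ : ℝ, 0 < ω₂ → 0 < lam → 0 < β → 0 < γ → ∀ T : ℝ, 0 < T → ∀ ε : ℝ, 0 < ε →
      ∃ s₀ : ℝ, 0 ≤ s₀ ∧ ∃ N₁ : ℕ, ∀ N : ℕ, N₁ ≤ N →
        ∫ s in Ioi s₀, contactProfile (pinnedChain ω₂ lam β γ) N T s ≤ ε) :
    stub_recurrentContactForgetting := by
  intro ω₂ lam β γ hω hl hβ hγ T hT ε hε
  obtain ⟨s₀, hs₀, N₁, hN₁⟩ := h ω₂ lam β γ hω hl hβ hγ T hT ε hε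
  exact ⟨s₀, hs₀, fun M => ⟨max M N₁, le_max_left _ _, hN₁ _ (le_max_right _ _)⟩⟩
/-- Statement of registered stub 7 (`Holds.stub_profileIntegrable`), by name. -/
def stub_profileIntegrable : Prop := type_of% Holds.stub_profileIntegrable

/-- Stub 1 IS the shared route item `HonestZwanzig.OpenChainGreenKubo` (stmt-AtomisticToContinuum-12696):
definitional unfolding of `totalCorr`/`totalCurrentObs`/`evolve` against the item's `let`s. -/
theorem openChainGreenKubo_iff : stub_openChainGreenKubo ↔ OpenChainGreenKubo := Iff.rfl

/-! ## Composition (sorry-free) -/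

/-- Step A (GK + DB + CF + MP): Green–Kubo for the extreme pair, `T²·(D_N/(N−1)) = ∫₀^∞ M_N(0,N−2)`, with the
integrand integrable. `D_N = ∫₀^∞corr(J,J)/((N−1)T²)` by uniqueness of limits along `𝓝[≠] 0` (GK vs the crux's own
response hypothesis); `∫₀^∞corr(J,J) = Σ_{b,b′<N−1}∫₀^∞M(b,b′)` (CF (i), integral of a finite sum of integrable
functions); `= Σ_b (N−1)∫M(b,0)` (CF (ii)); `= Σ_b (N−1)∫M(0,b)` (Onsager symmetry, MP (i) from DB);
`= (N−1)²∫M(0,0) = (N−1)²∫M(0,N−2)` (CF (ii) twice). -/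
theorem greenKubo_extremePair (h₁ : stub_openChainGreenKubo) (h₂ : stub_kernelDetailedBalance)
    (h₃ : stub_columnFlatGreenKubo) (h₅ : stub_midpointContraction)
    {ω₂ lam β γ : ℝ} (hω : 0 < ω₂) (hl : 0 < lam) (hβ : 0 < β) (hγ : 0 < γ)
    (huniq : ∀ (N : ℕ) (T_L T_R : ℝ), 0 < T_L → 0 < T_R → ∀ μ ν : Measure (PhaseSpace N),
      (pinnedChain ω₂ lam β γ).IsSteadyState N T_L T_R μ →
      (pinnedChain ω₂ lam β γ).IsSteadyState N T_L T_R ν → μ = ν)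
    (μ : (N : ℕ) → ℝ → ℝ → Measure (PhaseSpace N))
    (hμ : ∀ (N : ℕ) (T_L T_R : ℝ), 0 < T_L → 0 < T_R →
      (pinnedChain ω₂ lam β γ).IsSteadyState N T_L T_R (μ N T_L T_R))
    {T : ℝ} (hT : 0 < T) (D : ℕ → ℝ)
    (hD : ∀ N : ℕ, Tendsto (fun δ : ℝ =>
      (pinnedChain ω₂ lam β γ).totalCurrent (μ N (T + δ / 2) (T - δ / 2)) / δ)
      (nhdsWithin 0 {(0 : ℝ)}ᶜ) (nhds (D N)))
    {N : ℕ} (hN : 2 ≤ N) :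
    IntegrableOn (gkEntry (pinnedChain ω₂ lam β γ) N T 0 (N - 2)) (Ioi 0) ∧
      T ^ 2 * (D N / ((N : ℝ) - 1)) =
        ∫ t in Ioi (0 : ℝ), gkEntry (pinnedChain ω₂ lam β γ) N T 0 (N - 2) t := by
  set P := pinnedChain ω₂ lam β γ with hP
  obtain ⟨-, hlim⟩ := h₁ ω₂ lam β γ hω hl hβ hγ huniq μ hμ T hT N hN
  obtain ⟨hsum, hflat⟩ := h₃ ω₂ lam β γ hω hl hβ hγ T hT N hN
  obtain ⟨hsymm, -⟩ := h₅ h₂ ω₂ lam β γ hω hl hβ hγ T hT N hN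
  have hDN : D N = (∫ t in Ioi (0 : ℝ), totalCorr P N T t) / (((N : ℝ) - 1) * T ^ 2) :=
    tendsto_nhds_unique (hD N) hlim
  have hN1 : (0 : ℝ) < (N : ℝ) - 1 := by
    have : (2 : ℝ) ≤ N := by exact_mod_cast hN
    linarith
  have hmemN : ∀ b ∈ Finset.range (N - 1), b + 1 < N := fun b hb => by
    have := Finset.mem_range.1 hb; omega
  have h0N : 0 + 1 < N := by omega
  have hN2N : (N - 2) + 1 < N := by omega
  -- integrability of every entry with both indices < N - 1
  have hint : ∀ b ∈ Finset.range (N - 1), ∀ b' ∈ Finset.range (N - 1),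
      IntegrableOn (gkEntry P N T b b') (Ioi 0) := fun b hb b' hb' => (hflat b b' (hmemN b hb) (hmemN b' hb')).1
  -- ∫ corr = Σ_b Σ_b' ∫ M(b,b')
  have hI1 : ∫ t in Ioi (0 : ℝ), totalCorr P N T t =
      ∑ b ∈ Finset.range (N - 1), ∑ b' ∈ Finset.range (N - 1), ∫ t in Ioi (0 : ℝ), gkEntry P N T b b' t := by
    have hcongr : ∫ t in Ioi (0 : ℝ), totalCorr P N T t =
        ∫ t in Ioi (0 : ℝ), ∑ b ∈ Finset.range (N - 1), ∑ b' ∈ Finset.range (N - 1), gkEntry P N T b b' t :=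
      setIntegral_congr_fun measurableSet_Ioi fun t ht => hsum t (le_of_lt ht)
    rw [hcongr, integral_finsetSum _ fun b hb => ?_]
    · refine Finset.sum_congr rfl fun b hb => ?_
      rw [integral_finsetSum _ fun b' hb' => hint b hb b' hb']
    · exact integrable_finsetSum _ fun b' hb' => hint b hb b' hb'
  -- every entry integrates to ∫ M(0, N-2)
  have hentry : ∀ b ∈ Finset.range (N - 1), ∀ b' ∈ Finset.range (N - 1),
      ∫ t in Ioi (0 : ℝ), gkEntry P N T b b' t = ∫ t in Ioi (0 : ℝ), gkEntry P N T 0 (N - 2) t := by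
    intro b hb b' hb'
    have e1 : ∫ t in Ioi (0 : ℝ), gkEntry P N T b b' t = ∫ t in Ioi (0 : ℝ), gkEntry P N T b 0 t :=
      (hflat b b' (hmemN b hb) (hmemN b' hb')).2
    have e2 : ∫ t in Ioi (0 : ℝ), gkEntry P N T b 0 t = ∫ t in Ioi (0 : ℝ), gkEntry P N T 0 b t :=
      setIntegral_congr_fun measurableSet_Ioi fun t ht => hsymm b 0 t (le_of_lt ht)
    have e3 : ∫ t in Ioi (0 : ℝ), gkEntry P N T 0 b t = ∫ t in Ioi (0 : ℝ), gkEntry P N T 0 0 t :=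
      (hflat 0 b h0N (hmemN b hb)).2
    have e4 : ∫ t in Ioi (0 : ℝ), gkEntry P N T 0 (N - 2) t = ∫ t in Ioi (0 : ℝ), gkEntry P N T 0 0 t :=
      (hflat 0 (N - 2) h0N hN2N).2
    rw [e1, e2, e3, e4]
  have hI2 : ∫ t in Ioi (0 : ℝ), totalCorr P N T t =
      ((N : ℝ) - 1) ^ 2 * ∫ t in Ioi (0 : ℝ), gkEntry P N T 0 (N - 2) t := by
    rw [hI1, Finset.sum_congr rfl fun b hb => Finset.sum_congr rfl fun b' hb' => hentry b hb b' hb']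
    simp only [Finset.sum_const, Finset.card_range, nsmul_eq_mul]
    have : ((N - 1 : ℕ) : ℝ) = (N : ℝ) - 1 := by
      rw [Nat.cast_sub (by omega)]; simp
    rw [this]; ring
  refine ⟨(hflat 0 (N - 2) h0N hN2N).1, ?_⟩
  rw [hDN, hI2]
  field_simp

/-- **`NonBallistic_of_all` — the master composition** from the seven statements of the line (four of them now
theorems), written against the `Iff.rfl`-identical twin `PuiseuxTransferLedger.NonBallistic` so that the unary
`NonBallistic_of` below is the first declaration concluding the crux by name. With `t₀, η` from LC, `s₀` from RCF at
tolerance `T²ε/8`, `N₂` such that both eventualities `η_N t₀(N) < T²ε/4`, `2s₀ ≤ t₀(N)` hold for all `N ≥ N₂`, and ONE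
`N ≥ max(N₀, N₂, 2)` with `∫_{s₀}^∞ φ_N ≤ T²ε/8` (RCF):
`T²·(D_N/(N−1)) = ∫₀^{t₀}M + ∫_{t₀}^∞ M ≤ η_N t₀ + 2∫_{t₀/2}^∞ φ_N ≤ η_N t₀ + 2∫_{s₀}^∞ φ_N < T²ε/4 + T²ε/4`. [folklore] -/
theorem NonBallistic_of_all (h₁ : stub_openChainGreenKubo) (h₂ : stub_kernelDetailedBalance)
    (h₃ : stub_columnFlatGreenKubo) (h₄ : stub_lightConeWindow) (h₅ : stub_midpointContraction)
    (h₆ : stub_recurrentContactForgetting) (h₇ : stub_profileIntegrable) :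
    Summit.AtomisticToContinuum.FouriersLaw.Theses.PuiseuxTransferLedger.NonBallistic := by
  intro ω₂ lam β γ hω hl hβ hγ huniq μ hμ T hT D hD ε hε N₀
  set P := pinnedChain ω₂ lam β γ with hP
  have hT2 : 0 < T ^ 2 := by positivity
  have hε4 : 0 < T ^ 2 * ε / 4 := by positivity
  have hε8 : 0 < T ^ 2 * ε / 8 := by positivity
  -- the light-cone window (LC), the recurrent tail time (RCF), integrability (PI)
  obtain ⟨t₀, η, ht₀0, ht₀top, hηt₀, hLC⟩ := h₄ ω₂ lam β γ hω hl hβ hγ T hT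
  obtain ⟨s₀, hs₀, hrec⟩ := h₆ ω₂ lam β γ hω hl hβ hγ T hT (T ^ 2 * ε / 8) hε8
  have hφintAll : ∀ N : ℕ, 2 ≤ N → IntegrableOn (contactProfile P N T) (Ioi 0) :=
    fun N hN => h₇ ω₂ lam β γ hω hl hβ hγ T hT N hN
  -- two eventualities, valid for ALL large N
  have hev1 : ∀ᶠ N : ℕ in atTop, η N * t₀ N < T ^ 2 * ε / 4 := hηt₀.eventually (gt_mem_nhds hε4)
  have hev2 : ∀ᶠ N : ℕ in atTop, 2 * s₀ ≤ t₀ N := ht₀top.eventually_ge_atTop (2 * s₀)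
  obtain ⟨N₂, hN₂⟩ := eventually_atTop.1 (hev1.and hev2)
  -- the chain: ONE length beyond N₀, N₂, 2 with a small profile tail (RCF)
  obtain ⟨N, hN₁N, htailN⟩ := hrec (max (max N₀ N₂) 2)
  have hNN₀ : N₀ ≤ N := le_trans (le_trans (le_max_left _ _) (le_max_left _ _)) hN₁N
  have hNN₂ : N₂ ≤ N := le_trans (le_trans (le_max_right _ _) (le_max_left _ _)) hN₁N
  have hN2 : 2 ≤ N := le_trans (le_max_right _ _) hN₁N
  obtain ⟨hηN, hs₀t₀⟩ := hN₂ N hNN₂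
  have hN1 : (0 : ℝ) < (N : ℝ) - 1 := by
    have : (2 : ℝ) ≤ N := by exact_mod_cast hN2
    linarith
  refine ⟨N, hNN₀, ?_⟩
  -- Green–Kubo for the extreme pair (GK + DB + CF + MP)
  obtain ⟨hint, hGK⟩ := greenKubo_extremePair h₁ h₂ h₃ h₅ hω hl hβ hγ huniq μ hμ hT D hD hN2
  -- the midpoint bound (MP from DB)
  obtain ⟨-, hmid⟩ := h₅ h₂ ω₂ lam β γ hω hl hβ hγ T hT N hN2
  set g : ℝ → ℝ := gkEntry P N T 0 (N - 2) with hgdef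
  set φ : ℝ → ℝ := contactProfile P N T with hφdef
  have hφint : IntegrableOn φ (Ioi 0) := hφintAll N hN2
  have hφ0 : ∀ s, 0 ≤ φ s := fun s => contactProfile_nonneg P N T s
  have ht₀N : 0 ≤ t₀ N := ht₀0 N
  -- split the time integral at the window
  have hsplit : ∫ t in Ioi (0 : ℝ), g t = (∫ t in Ioc 0 (t₀ N), g t) + ∫ t in Ioi (t₀ N), g t := by
    rw [← setIntegral_union Ioc_disjoint_Ioi_same measurableSet_Ioi
      (hint.mono_set Ioc_subset_Ioi_self) (hint.mono_set (Ioi_subset_Ioi ht₀N)),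
      Ioc_union_Ioi_eq_Ioi ht₀N]
  -- inside the window: pointwise small (LC)
  have hB1 : ‖∫ t in Ioc 0 (t₀ N), g t‖ ≤ η N * t₀ N := by
    have h := norm_setIntegral_le_of_norm_le_const (μ := (volume : Measure ℝ)) (f := g)
      (s := Ioc 0 (t₀ N)) (C := η N) measure_Ioc_lt_top
      (fun t ht => by rw [Real.norm_eq_abs]; exact hLC N hN2 t ht.1.le ht.2)
    rwa [Real.volume_real_Ioc_of_le ht₀N, sub_zero] at h
  -- beyond the window: midpoint Cauchy–Schwarz (MP), then substitute s = t/2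
  have hφhalf : IntegrableOn (fun t => φ (2⁻¹ * t)) (Ioi (t₀ N)) := by
    rw [integrableOn_Ioi_comp_mul_left_iff φ (t₀ N) (by norm_num : (0 : ℝ) < 2⁻¹)]
    exact hφint.mono_set (Ioi_subset_Ioi (by positivity))
  have hB2a : ‖∫ t in Ioi (t₀ N), g t‖ ≤ ∫ t in Ioi (t₀ N), ‖g t‖ := norm_integral_le_integral_norm _
  have hB2b : ∫ t in Ioi (t₀ N), ‖g t‖ ≤ ∫ t in Ioi (t₀ N), φ (2⁻¹ * t) := by
    refine setIntegral_mono_on (hint.mono_set (Ioi_subset_Ioi ht₀N)).norm hφhalf measurableSet_Ioi ?_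
    intro t ht
    have ht0 : 0 ≤ t := le_trans ht₀N (le_of_lt ht)
    have h3 := hmid t ht0
    rw [Real.norm_eq_abs]
    have : t / 2 = 2⁻¹ * t := by ring
    rw [this] at h3
    exact h3
  have hB2c : ∫ t in Ioi (t₀ N), φ (2⁻¹ * t) = 2 * ∫ s in Ioi (2⁻¹ * t₀ N), φ s := by
    rw [integral_comp_mul_left_Ioi φ (t₀ N) (by norm_num : (0 : ℝ) < 2⁻¹), smul_eq_mul, inv_inv]
  -- the tail of the profile beyond t₀/2 ≥ s₀ (RCF)
  have hs₀half : s₀ ≤ 2⁻¹ * t₀ N := by linarith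
  have hB3 : ∫ s in Ioi (2⁻¹ * t₀ N), φ s ≤ ∫ s in Ioi s₀, φ s :=
    setIntegral_mono_set (hφint.mono_set (Ioi_subset_Ioi hs₀)) (ae_of_all _ hφ0)
      (Ioi_subset_Ioi hs₀half).eventuallyLE
  -- assemble
  have hmain : T ^ 2 * (D N / ((N : ℝ) - 1)) < T ^ 2 * ε := by
    have hA : ∫ t in Ioc 0 (t₀ N), g t ≤ η N * t₀ N :=
      le_trans (le_abs_self _) (by simpa [Real.norm_eq_abs] using hB1)
    have hBB : ∫ t in Ioi (t₀ N), g t ≤ 2 * (T ^ 2 * ε / 8) := by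
      calc ∫ t in Ioi (t₀ N), g t ≤ ‖∫ t in Ioi (t₀ N), g t‖ := by
            rw [Real.norm_eq_abs]; exact le_abs_self _
        _ ≤ ∫ t in Ioi (t₀ N), φ (2⁻¹ * t) := hB2a.trans hB2b
        _ = 2 * ∫ s in Ioi (2⁻¹ * t₀ N), φ s := hB2c
        _ ≤ 2 * ∫ s in Ioi s₀, φ s := by linarith [hB3]
        _ ≤ 2 * (T ^ 2 * ε / 8) := by linarith [htailN]
    rw [hGK, hsplit]
    linarith
  have hG : D N / ((N : ℝ) - 1) < ε := lt_of_mul_lt_mul_left hmain hT2.le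
  exact ((div_lt_iff₀ hN1).1 hG).le

/-- **`NonBallistic_of` — the skeleton concludes the crux BY NAME** (`JunctionLocality.NonBallistic`,
stmt-AtomisticToContinuum-9127) from the ONE remaining registered stub RCF; the six landed statements GK (p94764,
`openChainGreenKubo_holds`), DB (p91142, `SubdiffusiveBondHeat.stub_kernelDetailedBalance`), CF (p89265), LC (p92000),
MP (p85980), PI (p85907) are discharged inside (`Holds.stub_*` are theorems). [folklore] -/
theorem NonBallistic_of (h₆ : stub_recurrentContactForgetting) : NonBallistic :=
  NonBallistic_of_all Holds.stub_openChainGreenKubo Holds.stub_kernelDetailedBalance Holds.stub_columnFlatGreenKubo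
    Holds.stub_lightConeWindow Holds.stub_midpointContraction h₆ Holds.stub_profileIntegrable

/-- The shared twin: `PuiseuxTransferLedger.NonBallistic` (route `route-AtomisticToContinuum-PuiseuxTransferLedger`,
rank 3) is the same proposition (verbatim signature; `Disproof.lean` `nonBallistic_iff_puiseux` is `Iff.rfl`). [folklore] -/
theorem NonBallistic_puiseux_of (h₆ : stub_recurrentContactForgetting) :
    Summit.AtomisticToContinuum.FouriersLaw.Theses.PuiseuxTransferLedger.NonBallistic :=
  NonBallistic_of h₆

/-- The second shared twin: `BondHeatUncertainty.NonBallistic` (support; verbatim signature, `Disproof.lean`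
`nonBallistic_iff_bondHeat` is `Iff.rfl`; it is the decl the ledger resolves the item to by default). [folklore] -/
theorem NonBallistic_bondHeat_of (h₆ : stub_recurrentContactForgetting) :
    Summit.AtomisticToContinuum.FouriersLaw.Theses.BondHeatUncertainty.NonBallistic :=
  NonBallistic_of h₆

/-- D-0027 §3.3 shape: **`NonBallistic_proof`** — the crux (`JunctionLocality.NonBallistic`, by name) from the ONE
REGISTERED stub still open; it depends on `sorryAx` exactly through `Holds.stub_recurrentContactForgetting` and
becomes a proof once that `sorry` is discharged (`NonBallistic_of` stays the sorry-free composition). -/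
theorem NonBallistic_proof : NonBallistic :=
  NonBallistic_of Holds.stub_recurrentContactForgetting

end Summit.AtomisticToContinuum.FouriersLaw.Cruxes.NonBallistic.ContactCurrentForgetting

end
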